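import Literature.RingTheory.RegularLocalRing.SopRegular
import Literature.RingTheory.GradedAlgebra.HomogeneousAssociatedPrimes
import Literature.AlgebraicGeometry.Resolution.OriginLocalRing
import Literature.AlgebraicGeometry.Motives.HypersurfaceFormsNonsingular
import Mathlib.RingTheory.MvPolynomial.Homogeneous
import HarnessLib

/-!
# Crux `PadicSemiregularLift.SemiregularSeedsOnAnchors` (stmt-HodgeConjecture-13941), line
# `gorenstein-ci-seeds`, stub S2 `stub_serreBundle_exists`: regular-sequence facts for a CI-type
# factorisation `F = Σ fᵢ gᵢ` of a nonsingular form

LOG (worker S2, 2026-08-16). Primes over `(f, g)` (`F = Σ fᵢ gᵢ` NONSINGULAR, `fᵢ, gᵢ` of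
positive degree) contain `F`, all `∂ⱼF`, hence all variables: `(f, g)` and e.g.
`(F, fᵢ, fⱼ, gᵢ, gⱼ, f_l + g_l)` are systems of parameters of the regular local ring `k[x]_{(x)}`,
hence regular sequences in any order (tree `isRegular_of_maximalIdeal_pow_le_ofList`, Matsumura
17.4); the statements descend to `k[x]` for homogeneous ideals (lowest-degree argument).

Contents (theorem-only): saturation of homogeneous ideals w.r.t. polynomials with a constant
term; the ENGINE `exists_mul_mem_ofList_take` / `mem_ofList_take_of_mul_mem`; and for `F = Σ fᵢ gᵢ`
nonsingular the non-zero-divisor statements `fⱼ ∤₀ (fᵢ)`, `f_l ∤₀ (fᵢ,fⱼ)`, `fᵢ, gᵢ ∤₀ (F)`,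
`gⱼ ∤₀ (F,fᵢ)` and the registered sub-goal `mem_span_pair_of_mul_mem_of_sum_mul_eq`:
`fⱼ u ∈ (F,fᵢ) ⟹ u ∈ (F,fᵢ)` (`i ≠ j`; `Z` is locally a codimension-`2` CI in `X`).
-/

noncomputable section

-- `Summit.HodgeConjecture.HodgeConjecture.…` (summit = problem) duplicates a namespace component by design (D-0017).
set_option linter.dupNamespace false

open MvPolynomial IsLocalRing
open Literature.AlgebraicGeometry.Resolution Literature.AlgebraicGeometry.Motives

universe u

namespace Summit.HodgeConjecture.HodgeConjecture.Theorems.SemiregularSeedsOnAnchors.GorensteinCiSeeds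

variable {k : Type u} [Field k]

section Graded

variable {n : ℕ}

/-- A homogeneous ideal `I ⊆ k[x₁,…,xₙ]` is saturated with respect to every polynomial `s` with
`s(0) ≠ 0`: `s u ∈ I ⟹ u ∈ I` (the lowest homogeneous component of `s` is the unit `s(0)`;
tree: `GradedAlgebra.exists_pow_mul_mem_of_mul_mem`). [folklore] -/
theorem mem_of_mul_mem_of_constantCoeff_ne_zero {I : Ideal (MvPolynomial (Fin n) k)}
    (hI : letI := MvPolynomial.gradedAlgebra (σ := Fin n) (R := k)
      I.IsHomogeneous (MvPolynomial.homogeneousSubmodule (Fin n) k))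
    {s u : MvPolynomial (Fin n) k} (hs : constantCoeff s ≠ 0) (hsu : s * u ∈ I) : u ∈ I := by
  letI := MvPolynomial.gradedAlgebra (σ := Fin n) (R := k)
  have hc : (C (constantCoeff s) : MvPolynomial (Fin n) k) ∈
      MvPolynomial.homogeneousSubmodule (Fin n) k 0 :=
    (MvPolynomial.mem_homogeneousSubmodule _ _).mpr (isHomogeneous_C _ _)
  have h0 : ((DirectSum.decompose (MvPolynomial.homogeneousSubmodule (Fin n) k) s 0 :
      MvPolynomial (Fin n) k)) = C (constantCoeff s) := by
    rw [constantCoeff_eq, ← homogeneousComponent_zero]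
    exact MvPolynomial.decomposition.decompose'_apply s 0
  obtain ⟨K, hK⟩ := Literature.RingTheory.GradedAlgebra.exists_pow_mul_mem_of_mul_mem
    (MvPolynomial.homogeneousSubmodule (Fin n) k) hI hc (fun i hi => absurd hi (Nat.not_lt_zero i))
    h0 hsu
  have hunit : IsUnit ((C (constantCoeff s) : MvPolynomial (Fin n) k) ^ K) :=
    ((isUnit_iff_ne_zero.mpr hs).map C).pow K
  exact (Ideal.unit_mul_mem_iff_mem I hunit).mp hK

/-- Ideals generated by homogeneous polynomials are homogeneous (Mathlib `Ideal.homogeneous_span`).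
[folklore] -/
theorem isHomogeneous_span_of_forall_isHomogeneous {S : Set (MvPolynomial (Fin n) k)}
    (hS : ∀ q ∈ S, ∃ d, q.IsHomogeneous d) :
    letI := MvPolynomial.gradedAlgebra (σ := Fin n) (R := k)
    (Ideal.span S).IsHomogeneous (MvPolynomial.homogeneousSubmodule (Fin n) k) := by
  letI := MvPolynomial.gradedAlgebra (σ := Fin n) (R := k)
  classical
  refine Ideal.homogeneous_span _ _ fun q hq => ?_
  obtain ⟨d, hd⟩ := hS q hq
  exact ⟨d, (MvPolynomial.mem_homogeneousSubmodule _ _).mpr hd⟩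

end Graded

section Engine

variable {n : ℕ}

/-- **Systems of parameters at the origin are regular sequences, read in `k[x]`.** Let
`Q = (Q₀, …, Q_{n-1})` be `n` polynomials of `k[x₁,…,xₙ]` without constant term such that every
prime ideal containing them contains all the variables (`(Q)` is primary to the ideal of the
origin). Then `Qᵢ · u ∈ (Q₀, …, Q_{i-1})` forces `s · u ∈ (Q₀, …, Q_{i-1})` for some `s` with
`s(0) ≠ 0`: in the regular local ring `k[x]_{(x)}` (dimension `n`) the `Qᵢ` are a system of
parameters, hence a regular sequence (tree `isRegular_of_maximalIdeal_pow_le_ofList`).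
[cite: Matsumura1987, Thm. 17.4 (iii)] -/
theorem exists_mul_mem_ofList_take (Q : List (MvPolynomial (Fin n) k)) (hlen : Q.length = n)
    (h0 : ∀ q ∈ Q, constantCoeff q = 0)
    (hrad : ∀ 𝔭 : Ideal (MvPolynomial (Fin n) k), 𝔭.IsPrime → Ideal.ofList Q ≤ 𝔭 →
      ∀ j, (X j : MvPolynomial (Fin n) k) ∈ 𝔭)
    {i : ℕ} (hi : i < Q.length) {u : MvPolynomial (Fin n) k}
    (hu : Q[i] * u ∈ Ideal.ofList (Q.take i)) :
    ∃ s : MvPolynomial (Fin n) k, constantCoeff s ≠ 0 ∧ s * u ∈ Ideal.ofList (Q.take i) := by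
  classical
  -- the local ring at the origin and the extended data
  have h𝔪 : (originIdeal k n).IsMaximal := inferInstance
  obtain ⟨N, hN⟩ : ∃ N, originIdeal k n ^ N ≤ Ideal.ofList Q := by
    apply Ideal.exists_pow_le_of_le_radical_of_fg _ (IsNoetherian.noetherian _)
    rw [Ideal.radical_eq_sInf, originIdeal_eq_span]
    refine le_sInf ?_
    rintro 𝔭 ⟨hQ𝔭, h𝔭⟩
    rw [Ideal.span_le]
    rintro _ ⟨j, rfl⟩
    exact hrad 𝔭 h𝔭 hQ𝔭 j
  set φ := algebraMap (MvPolynomial (Fin n) k) (OriginLocalization k n) with hφ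
  set Q' : List (OriginLocalization k n) := Q.map φ with hQ'
  have hQ'm : ∀ q ∈ Q', q ∈ maximalIdeal (OriginLocalization k n) := by
    intro q hq
    rw [hQ', List.mem_map] at hq
    obtain ⟨q₀, hq₀, rfl⟩ := hq
    exact (IsLocalization.AtPrime.to_map_mem_maximal_iff (OriginLocalization k n) (originIdeal k n)
      q₀).mpr ((mem_originIdeal_iff k n).mpr (h0 q₀ hq₀))
  have hlen' : ((Q'.length : ℕ) : WithBot ℕ∞) = ringKrullDim (OriginLocalization k n) := by
    rw [ringKrullDim_originLocalization, hQ', List.length_map, hlen]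
  have hN' : maximalIdeal (OriginLocalization k n) ^ N ≤ Ideal.ofList Q' := by
    rw [← IsLocalization.AtPrime.map_eq_maximalIdeal (originIdeal k n) (OriginLocalization k n),
      ← Ideal.map_pow, hQ', ← Ideal.map_ofList]
    exact Ideal.map_mono hN
  have hreg := Literature.RingTheory.RegularLocalRing.isRegular_of_maximalIdeal_pow_le_ofList
    hQ'm hlen' hN'
  -- regularity of `Q'ᵢ` modulo the prefix
  have hi' : i < Q'.length := by rw [hQ', List.length_map]; exact hi
  have hsm := hreg.toIsWeaklyRegular.regular_mod_prev i hi'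
  have hQi : Q'[i] = φ Q[i] := List.getElem_map _
  have htk : Q'.take i = (Q.take i).map φ := by rw [hQ', List.map_take]
  have hu' : Q'[i] * φ u ∈ Ideal.ofList (Q'.take i) := by
    rw [hQi, htk, ← Ideal.map_ofList, ← map_mul]
    exact Ideal.mem_map_of_mem _ hu
  have hI : (Ideal.ofList (Q'.take i) • ⊤ : Submodule (OriginLocalization k n)
      (OriginLocalization k n)) = (Ideal.ofList (Q'.take i)).restrictScalars _ := by
    rw [Ideal.smul_eq_mul, Ideal.mul_top]
    rfl
  have hmk : (Submodule.Quotient.mk (φ u) :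
      OriginLocalization k n ⧸ (Ideal.ofList (Q'.take i) • ⊤ :
        Submodule (OriginLocalization k n) (OriginLocalization k n))) = 0 := by
    refine hsm ?_
    change Q'[i] • (Submodule.Quotient.mk (φ u)) = Q'[i] • (0 : OriginLocalization k n ⧸
      (Ideal.ofList (Q'.take i) • ⊤ : Submodule (OriginLocalization k n) (OriginLocalization k n)))
    rw [smul_zero, ← Submodule.Quotient.mk_smul, Submodule.Quotient.mk_eq_zero, hI, smul_eq_mul]
    exact hu'
  rw [Submodule.Quotient.mk_eq_zero, hI] at hmk
  change φ u ∈ Ideal.ofList (Q'.take i) at hmk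
  rw [htk, ← Ideal.map_ofList,
    IsLocalization.algebraMap_mem_map_algebraMap_iff (originIdeal k n).primeCompl] at hmk
  obtain ⟨s, hs, hsu⟩ := hmk
  exact ⟨s, fun h => (Ideal.mem_primeCompl_iff.mp hs) ((mem_originIdeal_iff k n).mpr h), hsu⟩

/-- The engine with a HOMOGENEOUS prefix: then `Qᵢ · u ∈ (Q₀,…,Q_{i-1}) ⟹ u ∈ (Q₀,…,Q_{i-1})`
(`mem_of_mul_mem_of_constantCoeff_ne_zero`). [cite: Matsumura1987, Thm. 17.4 (iii)] -/
theorem mem_ofList_take_of_mul_mem (Q : List (MvPolynomial (Fin n) k)) (hlen : Q.length = n)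
    (h0 : ∀ q ∈ Q, constantCoeff q = 0)
    (hrad : ∀ 𝔭 : Ideal (MvPolynomial (Fin n) k), 𝔭.IsPrime → Ideal.ofList Q ≤ 𝔭 →
      ∀ j, (X j : MvPolynomial (Fin n) k) ∈ 𝔭)
    {i : ℕ} (hi : i < Q.length) (hhom : ∀ q ∈ Q.take i, ∃ d, q.IsHomogeneous d)
    {u : MvPolynomial (Fin n) k} (hu : Q[i] * u ∈ Ideal.ofList (Q.take i)) :
    u ∈ Ideal.ofList (Q.take i) := by
  obtain ⟨s, hs, hsu⟩ := exists_mul_mem_ofList_take Q hlen h0 hrad hi hu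
  exact mem_of_mul_mem_of_constantCoeff_ne_zero
    (isHomogeneous_span_of_forall_isHomogeneous fun q hq => hhom q hq) hs hsu

/-- The engine for the SECOND member of the list modulo the first (homogeneous) one:
`b u ∈ (a) ⟹ u ∈ (a)`. [folklore] -/
theorem mem_span_singleton_of_engine {a b : MvPolynomial (Fin n) k}
    {rest : List (MvPolynomial (Fin n) k)} (hlen : (a :: b :: rest).length = n)
    (h0 : ∀ q ∈ a :: b :: rest, constantCoeff q = 0)
    (hrad : ∀ 𝔭 : Ideal (MvPolynomial (Fin n) k), 𝔭.IsPrime → Ideal.ofList (a :: b :: rest) ≤ 𝔭 →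
      ∀ j, (X j : MvPolynomial (Fin n) k) ∈ 𝔭)
    (ha : ∃ d, a.IsHomogeneous d) {u : MvPolynomial (Fin n) k} (hu : b * u ∈ Ideal.span {a}) :
    u ∈ Ideal.span {a} := by
  have h1 : 1 < (a :: b :: rest).length := by simp
  have htake : (a :: b :: rest).take 1 = [a] := rfl
  have key := mem_ofList_take_of_mul_mem (a :: b :: rest) hlen h0 hrad h1
    (fun q hq => by rw [htake, List.mem_singleton] at hq; exact hq ▸ ha) (u := u)
    (by rw [htake, Ideal.ofList_singleton]; exact hu)
  rwa [htake, Ideal.ofList_singleton] at key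

/-- The engine for the THIRD member of the list modulo the first two (homogeneous) ones:
`c u ∈ (a, b) ⟹ u ∈ (a, b)`. [folklore] -/
theorem mem_span_pair_of_engine {a b c : MvPolynomial (Fin n) k}
    {rest : List (MvPolynomial (Fin n) k)} (hlen : (a :: b :: c :: rest).length = n)
    (h0 : ∀ q ∈ a :: b :: c :: rest, constantCoeff q = 0)
    (hrad : ∀ 𝔭 : Ideal (MvPolynomial (Fin n) k), 𝔭.IsPrime →
      Ideal.ofList (a :: b :: c :: rest) ≤ 𝔭 → ∀ j, (X j : MvPolynomial (Fin n) k) ∈ 𝔭)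
    (ha : ∃ d, a.IsHomogeneous d) (hb : ∃ d, b.IsHomogeneous d) {u : MvPolynomial (Fin n) k}
    (hu : c * u ∈ Ideal.span {a, b}) : u ∈ Ideal.span {a, b} := by
  have h2 : 2 < (a :: b :: c :: rest).length := by simp
  have htake : (a :: b :: c :: rest).take 2 = [a, b] := rfl
  have hspan : Ideal.ofList [a, b] = Ideal.span {a, b} := by
    rw [Ideal.ofList_cons, Ideal.ofList_singleton, Ideal.span_insert]
  have key := mem_ofList_take_of_mul_mem (a :: b :: c :: rest) hlen h0 hrad h2
    (fun q hq => by
      rw [htake] at hq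
      simp only [List.mem_cons, List.not_mem_nil, or_false] at hq
      rcases hq with rfl | rfl
      exacts [ha, hb]) (u := u)
    (by rw [htake, hspan]; exact hu)
  rwa [htake, hspan] at key

end Engine

section CI

variable {F : MvPolynomial (Fin 6) k} {m : ℕ} {f g : Fin 3 → MvPolynomial (Fin 6) k}
  {d e : Fin 3 → ℕ}

/-- A form of positive degree has no constant term. [folklore] -/
theorem constantCoeff_eq_zero_of_isHomogeneous_of_pos {σ : Type*} {φ : MvPolynomial σ k} {a : ℕ}
    (hφ : φ.IsHomogeneous a) (ha : 0 < a) : constantCoeff φ = 0 := by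
  rw [constantCoeff_eq]
  exact hφ.coeff_eq_zero (by rw [map_zero]; exact ha.ne)

/-- Three distinct indices exhaust `Fin 3`. [folklore] -/
theorem fin_three_eq_or : ∀ (i j l : Fin 3), i ≠ j → i ≠ l → j ≠ l → ∀ t : Fin 3,
    t = i ∨ t = j ∨ t = l := by decide
/-- Given `i ≠ j` in `Fin 3` there is a third index. [folklore] -/
theorem fin_three_exists_third : ∀ (i j : Fin 3), i ≠ j → ∃ l : Fin 3, i ≠ l ∧ j ≠ l := by decide

/-- **Primes over `F, fᵢ, fⱼ, gᵢ, gⱼ, f_l + g_l` contain all six forms** (`{i,j,l} = {1,2,3}`):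
`f_l g_l = F − fᵢgᵢ − fⱼgⱼ ∈ 𝔭` puts `f_l` or `g_l`, hence (with `f_l + g_l ∈ 𝔭`) both, in `𝔭`.
[folklore] -/
theorem forall_mem_of_mem (hsum : ∑ t, f t * g t = F) {𝔭 : Ideal (MvPolynomial (Fin 6) k)}
    (h𝔭 : 𝔭.IsPrime) (i j l : Fin 3) (hij : i ≠ j) (hil : i ≠ l) (hjl : j ≠ l) (hF : F ∈ 𝔭)
    (hfi : f i ∈ 𝔭) (hfj : f j ∈ 𝔭) (hgi : g i ∈ 𝔭) (hgj : g j ∈ 𝔭) (hl : f l + g l ∈ 𝔭) :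
    (∀ t, f t ∈ 𝔭) ∧ ∀ t, g t ∈ 𝔭 := by
  have hrest : ∑ t ∈ Finset.univ.erase l, f t * g t ∈ 𝔭 := Ideal.sum_mem _ fun t ht => by
    rcases fin_three_eq_or i j l hij hil hjl t with rfl | rfl | rfl
    exacts [Ideal.mul_mem_right _ _ hfi, Ideal.mul_mem_right _ _ hfj,
      absurd rfl (Finset.ne_of_mem_erase ht)]
  have hflgl : f l * g l ∈ 𝔭 := by
    rw [eq_sub_of_add_eq ((Finset.add_sum_erase Finset.univ (fun t => f t * g t)
      (Finset.mem_univ l)).trans hsum)]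
    exact Ideal.sub_mem _ hF hrest
  have hboth : f l ∈ 𝔭 ∧ g l ∈ 𝔭 := by
    rcases h𝔭.mem_or_mem hflgl with h | h
    · exact ⟨h, by simpa using Ideal.sub_mem _ hl h⟩
    · exact ⟨by simpa using Ideal.sub_mem _ hl h, h⟩
  refine ⟨fun t => ?_, fun t => ?_⟩ <;>
  rcases fin_three_eq_or i j l hij hil hjl t with rfl | rfl | rfl
  exacts [hfi, hfj, hboth.1, hgi, hgj, hboth.2]

/-- If a prime contains all `fᵢ, gᵢ` then it contains all the variables (`F` nonsingular:
`F, ∂ⱼF ∈ 𝔭` by Leibniz). [folklore] -/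
theorem forall_X_mem_of_forall_f_g_mem (hsum : ∑ t, f t * g t = F)
    (hJ : SmoothHypersurface.IsNonsingularForm k F) {𝔭 : Ideal (MvPolynomial (Fin 6) k)}
    (h𝔭 : 𝔭.IsPrime) (hf : ∀ t, f t ∈ 𝔭) (hg : ∀ t, g t ∈ 𝔭) (j : Fin 6) :
    (X j : MvPolynomial (Fin 6) k) ∈ 𝔭 := by
  refine hJ 𝔭 h𝔭 ?_ (fun j' => ?_) j
  · rw [← hsum]
    exact Ideal.sum_mem _ fun t _ => Ideal.mul_mem_left _ _ (hg t)
  · rw [← hsum, map_sum]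
    refine Ideal.sum_mem _ fun t _ => ?_
    rw [Derivation.leibniz, smul_eq_mul, smul_eq_mul]
    exact Ideal.add_mem _ (Ideal.mul_mem_right _ _ (hf t)) (Ideal.mul_mem_right _ _ (hg t))

/-- Given `i` in `Fin 3` there are two further distinct indices. [folklore] -/
theorem fin_three_exists_others : ∀ i : Fin 3, ∃ j l : Fin 3, i ≠ j ∧ i ≠ l ∧ j ≠ l := by decide

/-- Membership of list members in `Ideal.ofList`. [folklore] -/
theorem mem_ofList_of_mem {R : Type*} [CommSemiring R] {Q : List R} {q : R} (h : q ∈ Q) :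
    q ∈ Ideal.ofList Q := Ideal.subset_span h

/-- **Hypotheses of the engine for the standard parameter lists**: any list with the same members
as `(F, fᵢ, fⱼ, gᵢ, gⱼ, f_l + g_l)` (`{i,j,l} = {1,2,3}`) consists of polynomials without constant
term, and every prime over it contains all the variables. [folklore] -/
theorem engine_hyps_std (hF : F.IsHomogeneous m) (hm : 0 < m)
    (hf : ∀ t, (f t).IsHomogeneous (d t)) (hd : ∀ t, 0 < d t)
    (hg : ∀ t, (g t).IsHomogeneous (e t)) (he : ∀ t, 0 < e t) (hsum : ∑ t, f t * g t = F)
    (hJ : SmoothHypersurface.IsNonsingularForm k F) (i j l : Fin 3) (hij : i ≠ j) (hil : i ≠ l)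
    (hjl : j ≠ l) (Q : List (MvPolynomial (Fin 6) k))
    (hsub : ∀ q ∈ Q, q ∈ [F, f i, f j, g i, g j, f l + g l])
    (hsup : ∀ q ∈ [F, f i, f j, g i, g j, f l + g l], q ∈ Q) :
    (∀ q ∈ Q, constantCoeff q = 0) ∧
      ∀ 𝔭 : Ideal (MvPolynomial (Fin 6) k), 𝔭.IsPrime → Ideal.ofList Q ≤ 𝔭 →
        ∀ j, (X j : MvPolynomial (Fin 6) k) ∈ 𝔭 := by
  refine ⟨fun q hq => ?_, fun 𝔭 h𝔭 hle s => ?_⟩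
  · have hq' := hsub q hq
    simp only [List.mem_cons, List.not_mem_nil, or_false] at hq'
    rcases hq' with rfl | rfl | rfl | rfl | rfl | rfl <;>
      first
      | exact constantCoeff_eq_zero_of_isHomogeneous_of_pos hF hm
      | exact constantCoeff_eq_zero_of_isHomogeneous_of_pos (hf _) (hd _)
      | exact constantCoeff_eq_zero_of_isHomogeneous_of_pos (hg _) (he _)
      | rw [map_add, constantCoeff_eq_zero_of_isHomogeneous_of_pos (hf l) (hd l),
          constantCoeff_eq_zero_of_isHomogeneous_of_pos (hg l) (he l), add_zero]
  · have hmem : ∀ q ∈ [F, f i, f j, g i, g j, f l + g l], q ∈ 𝔭 := fun q hq =>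
      hle (mem_ofList_of_mem (hsup q hq))
    obtain ⟨hf', hg'⟩ := forall_mem_of_mem hsum h𝔭 i j l hij hil hjl (hmem _ (by simp))
      (hmem _ (by simp)) (hmem _ (by simp)) (hmem _ (by simp)) (hmem _ (by simp))
      (hmem _ (by simp))
    exact forall_X_mem_of_forall_f_g_mem hsum hJ h𝔭 hf' hg' s

/-- **`fⱼ` is a non-zero-divisor modulo `(F, fᵢ)`** (`i ≠ j`): for a nonsingular `F = Σ fₜ gₜ`
with forms `fₜ, gₜ` of positive degree, `fⱼ u ∈ (F, fᵢ) ⟹ u ∈ (F, fᵢ)` in `k[x₀,…,x₅]`, i.e.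
`(fᵢ, fⱼ)` is a regular sequence on `k[x]/(F)`: `V₊(f) ⊂ V₊(F)` is locally a codimension-`2`
complete intersection (the l.c.i. hypothesis of the Hartshorne–Serre correspondence). Registered
sub-goal of this file. [cite: Arrondo2007HartshorneSerre, Thm 1.1] -/
theorem mem_span_pair_of_mul_mem_of_sum_mul_eq :
    ∀ (k : Type u) [Field k] (m : ℕ) (_ : 0 < m) (F : MvPolynomial (Fin 6) k)
      (_ : F.IsHomogeneous m) (_ : SmoothHypersurface.IsNonsingularForm k F)
      (d e : Fin 3 → ℕ) (_ : ∀ t, 0 < d t) (_ : ∀ t, 0 < e t)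
      (f g : Fin 3 → MvPolynomial (Fin 6) k) (_ : ∀ t, (f t).IsHomogeneous (d t))
      (_ : ∀ t, (g t).IsHomogeneous (e t)) (_ : ∑ t, f t * g t = F) (i j : Fin 3) (_ : i ≠ j)
      (u : MvPolynomial (Fin 6) k) (_ : f j * u ∈ Ideal.span {F, f i}),
      u ∈ Ideal.span {F, f i} := by
  intro k _ m hm F hF hJ d e hd he f g hf hg hsum i j hij u hu
  obtain ⟨l, hil, hjl⟩ := fin_three_exists_third i j hij
  obtain ⟨h0, hrad⟩ := engine_hyps_std hF hm hf hd hg he hsum hJ i j l hij hil hjl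
    [F, f i, f j, g i, g j, f l + g l] (fun q hq => hq) (fun q hq => hq)
  exact mem_span_pair_of_engine (by simp) h0 hrad ⟨m, hF⟩ ⟨d i, hf i⟩ hu

/-- Hypotheses of the engine for the list `(fᵢ, fⱼ, f_l, gᵢ, gⱼ, g_l)` of the six forms
(`{i,j,l} = {1,2,3}`): no constant terms, and primes over it contain all variables. [folklore] -/
theorem engine_hyps_fff (hf : ∀ t, (f t).IsHomogeneous (d t)) (hd : ∀ t, 0 < d t)
    (hg : ∀ t, (g t).IsHomogeneous (e t)) (he : ∀ t, 0 < e t) (hsum : ∑ t, f t * g t = F)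
    (hJ : SmoothHypersurface.IsNonsingularForm k F) (i j l : Fin 3) (hij : i ≠ j) (hil : i ≠ l)
    (hjl : j ≠ l) :
    (∀ q ∈ [f i, f j, f l, g i, g j, g l], constantCoeff q = 0) ∧
      ∀ 𝔭 : Ideal (MvPolynomial (Fin 6) k), 𝔭.IsPrime →
        Ideal.ofList [f i, f j, f l, g i, g j, g l] ≤ 𝔭 →
          ∀ j, (X j : MvPolynomial (Fin 6) k) ∈ 𝔭 := by
  refine ⟨fun q hq => ?_, fun 𝔭 h𝔭 hle s => ?_⟩
  · simp only [List.mem_cons, List.not_mem_nil, or_false] at hq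
    rcases hq with rfl | rfl | rfl | rfl | rfl | rfl <;>
      first
      | exact constantCoeff_eq_zero_of_isHomogeneous_of_pos (hf _) (hd _)
      | exact constantCoeff_eq_zero_of_isHomogeneous_of_pos (hg _) (he _)
  · have hmem : ∀ q ∈ [f i, f j, f l, g i, g j, g l], q ∈ 𝔭 := fun q hq =>
      hle (mem_ofList_of_mem hq)
    refine forall_X_mem_of_forall_f_g_mem hsum hJ h𝔭 (fun t => ?_) (fun t => ?_) s <;>
      rcases fin_three_eq_or i j l hij hil hjl t with rfl | rfl | rfl <;> exact hmem _ (by simp)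

section Cor

variable (hF : F.IsHomogeneous m) (hm : 0 < m) (hf : ∀ t, (f t).IsHomogeneous (d t))
  (hd : ∀ t, 0 < d t) (hg : ∀ t, (g t).IsHomogeneous (e t)) (he : ∀ t, 0 < e t)
  (hsum : ∑ t, f t * g t = F) (hJ : SmoothHypersurface.IsNonsingularForm k F)
include hF hm hf hd hg he hsum hJ

/-- **`gⱼ` is a non-zero-divisor modulo `(F, fᵢ)`** (all `i, j`): `gⱼ u ∈ (F, fᵢ) ⟹ u ∈ (F, fᵢ)`.
[folklore] -/
theorem mem_span_pair_of_g_mul_mem (i j : Fin 3) {u : MvPolynomial (Fin 6) k}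
    (hu : g j * u ∈ Ideal.span {F, f i}) : u ∈ Ideal.span {F, f i} := by
  by_cases hij : i = j
  · subst hij
    obtain ⟨j, l, hij, hil, hjl⟩ := fin_three_exists_others i
    obtain ⟨h0, hrad⟩ := engine_hyps_std hF hm hf hd hg he hsum hJ i j l hij hil hjl
      [F, f i, g i, f j, g j, f l + g l] (by simp) (by simp)
    exact mem_span_pair_of_engine (by simp) h0 hrad ⟨m, hF⟩ ⟨d i, hf i⟩ hu
  · obtain ⟨l, hil, hjl⟩ := fin_three_exists_third i j hij
    obtain ⟨h0, hrad⟩ := engine_hyps_std hF hm hf hd hg he hsum hJ i j l hij hil hjl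
      [F, f i, g j, f j, g i, f l + g l] (by simp) (by simp)
    exact mem_span_pair_of_engine (by simp) h0 hrad ⟨m, hF⟩ ⟨d i, hf i⟩ hu

/-- **`fᵢ` is a non-zero-divisor modulo `F`**: `fᵢ u ∈ (F) ⟹ u ∈ (F)` (`F ∤ fᵢ`; `V₊(fᵢ) ∩ V₊(F)`
is a divisor of `X`). [folklore] -/
theorem mem_span_F_of_f_mul_mem (i : Fin 3) {u : MvPolynomial (Fin 6) k}
    (hu : f i * u ∈ Ideal.span {F}) : u ∈ Ideal.span {F} := by
  obtain ⟨j, l, hij, hil, hjl⟩ := fin_three_exists_others i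
  obtain ⟨h0, hrad⟩ := engine_hyps_std hF hm hf hd hg he hsum hJ i j l hij hil hjl
    [F, f i, f j, g i, g j, f l + g l] (fun q hq => hq) (fun q hq => hq)
  exact mem_span_singleton_of_engine (by simp) h0 hrad ⟨m, hF⟩ hu

/-- **`gᵢ` is a non-zero-divisor modulo `F`**: `gᵢ u ∈ (F) ⟹ u ∈ (F)`. [folklore] -/
theorem mem_span_F_of_g_mul_mem (i : Fin 3) {u : MvPolynomial (Fin 6) k}
    (hu : g i * u ∈ Ideal.span {F}) : u ∈ Ideal.span {F} := by
  obtain ⟨j, l, hij, hil, hjl⟩ := fin_three_exists_others i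
  obtain ⟨h0, hrad⟩ := engine_hyps_std hF hm hf hd hg he hsum hJ i j l hij hil hjl
    [F, g i, f i, f j, g j, f l + g l] (by simp) (by simp)
  exact mem_span_singleton_of_engine (by simp) h0 hrad ⟨m, hF⟩ hu

omit hF hm in
/-- **`(f₁, f₂, f₃)` is a regular sequence, first step**: `fⱼ u ∈ (fᵢ) ⟹ u ∈ (fᵢ)` (`i ≠ j`).
[folklore] -/
theorem mem_span_f_of_f_mul_mem (i j : Fin 3) (hij : i ≠ j)
    {u : MvPolynomial (Fin 6) k} (hu : f j * u ∈ Ideal.span {f i}) : u ∈ Ideal.span {f i} := by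
  obtain ⟨l, hil, hjl⟩ := fin_three_exists_third i j hij
  obtain ⟨h0, hrad⟩ := engine_hyps_fff hf hd hg he hsum hJ i j l hij hil hjl
  exact mem_span_singleton_of_engine (by simp) h0 hrad ⟨d i, hf i⟩ hu

omit hF hm in
/-- **`(f₁, f₂, f₃)` is a regular sequence, second step**: `f_l u ∈ (fᵢ, fⱼ) ⟹ u ∈ (fᵢ, fⱼ)`
(`i, j, l` distinct): `V₊(f)` has pure codimension `3` in `ℙ⁵`. [folklore] -/
theorem mem_span_pair_f_of_f_mul_mem (i j l : Fin 3) (hij : i ≠ j) (hil : i ≠ l)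
    (hjl : j ≠ l) {u : MvPolynomial (Fin 6) k} (hu : f l * u ∈ Ideal.span {f i, f j}) :
    u ∈ Ideal.span {f i, f j} := by
  obtain ⟨h0, hrad⟩ := engine_hyps_fff hf hd hg he hsum hJ i j l hij hil hjl
  exact mem_span_pair_of_engine (by simp) h0 hrad ⟨d i, hf i⟩ ⟨d j, hf j⟩ hu

end Cor

end CI
end Summit.HodgeConjecture.HodgeConjecture.Theorems.SemiregularSeedsOnAnchors.GorensteinCiSeeds

end
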